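import Summits.QuantumFields.YangMills.Theorems.UV3OrganOfGrowingMassEnvelopeV3
import Summits.QuantumFields.YangMills.Theorems.UV3UnitEnvelopeSlackOfMassEnvelope
import Summits.QuantumFields.YangMills.Theorems.UnitScaleTiltPinnedHeightTailDoorExpSlack
import Summits.QuantumFields.YangMills.Theorems.UV3PinnedStepV3FaceOfPackageV3
import Summits.QuantumFields.YangMills.Theorems.UV3UnitEnvelopeFaceOfPackageV3
import Summits.QuantumFields.YangMills.Theorems.UV3PinnedStepKnitOfPackageV3
import Summits.QuantumFields.YangMills.Theorems.UnitScaleTiltHistoryTailOfPinnedHeightTailFreeRate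
import HarnessLib

/-!
# R3 (cell `ym3-torus`, YM₃ on T³ — a ladder RUNG, NOT d = 4, NOT infinite volume, NOT a mass gap, NOT the Clay problem) — **THE 19936 CRUX FACE IN THE REGISTERED (v3)
# CURRENCY OVER THE RELAXED ROW hJ♭(v3) (and over hTop♭): `UnitScaleTilt.HistoryTailL` FROM THE GUARDED v3 (α) SOCKET, THE POLYMER FIELDS AND ONE KINEMATIC ROW WHOSE
# CONSTANT MAY GROW LINEARLY WITH THE RUN LENGTH** — the v3 twin of ✓`UnitScaleTiltHistoryTailOfPackageGrowingTopPartialIterates` (no `hMain` in v3), through LEAD's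
# exp-slack door ✓`UnitScaleTiltPinnedHeightTailDoorExpSlack.pinnedHeightTail_of_exp'` (K-24)

Seat `ym-ust-19936-w5` g18 (WIDTH-5 helper on stmt-QuantumFields-19936 `HistoryTailL`; NO claim on crux ∕ stub ∕ registry).  THEOREMS ONLY (0 `def`, 0 `sorry`);
`--supports stmt-QuantumFields-19936 --as helper`; count-neutral; CONDITIONAL — closes nothing.

THE POINT.  Registry v4 (ideator g17 01:59Z; ★★OWNER RECORD 17bi): rows `stub_laneRecordsV3`, `stub_hJ` = hJ(v3) (K-UNIFORM envelope of the pinned masses).  This file shows by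
kernel that the same skeleton shape closes the crux from the WEAKER row hJ♭(v3) «`massP_K(r,·) ≤ e^{A₁ + A₂·K}` a.e.» (and from hTop♭ via ✓`UV3OrganOfGrowingMassEnvelopeV3` §3):
S side ✓p749641 `stub_pinnedStepV3_of_packageV3_of_purePinTop (hpkg)(π)(hPinA)` ∘ ✓`hPinA_of_pinnedLF_v3 (π)(hSii)` ∘ ✓`AlphaInputsT3AC.OfV3At.hSii_of_growingMassEnvelope`;
U side §1–§2 (px12 g12's ✓`ae_emlDensity_top_le_of_lfTopV3_ae` re-run with a RUN-DEPENDENT leaf constant, then the halves with the slack `e^{A₂K}` carried —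
✓`UV3UnitEnvelopeSlackOfMassEnvelope.unitEnvelope_of_halves_slack` + ✓`exp_Ecst_le_partitionFn_of_packageV3`); door K-24 (`e^{A₂K} ≤ e^{A₂m}·β_{K−j}^{⌈A₂m∕log L⌉₊}` at the
constrained heights); socket ✓p748552.  So a registry re-cut `stub_hJ ↦ stub_hJ♭(v3)` (if the N08 summon delivers only a per-step constant) costs the write-slot holder one edit.

CONTENTS: §1 ★★ `ae_emlDensity_top_le_of_lfTopV3Run_ae` ((U″)-v3 with leaf `LF_K ≤ e^{CZ_K}` per run ⟹ `ρ_K ≤ e^{|CZ_K|}·e^{−Ecst_K + Cu''}`, `Cu''` K-free) · §2 ★★★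
`AlphaInputsT3AC.OfV3At.unitEnvelopeExp_of_growingMassEnvelope` (`∃ Cl A₂, 0 ≤ A₂ ∧ ∀ K, ρ_K ≤ e^{A₂K}·(e^{Cl}·Z_K)` a.e. — K-24's `hLowExp` body — from hJ♭(v3) and the two
window thresholds) · §3 the `∀ L` letters at the guarded v3 socket: ★★ `unitEnvelopeExp_forall_of_packageV3_of_growingMassEnvelope`, ★★ `purePinTop_forall_of_growingMassEnvelope`
(✓p749641's `hPinA`) · §4 ★★★ `pinnedHeightTail_of_packageV3_of_growingMassEnvelope` (`hP′` VERBATIM), ★★★★ `historyTailL_of_packageV3_of_growingMassEnvelope (hpkg)(π)(hJ♭∀) :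
…Theses.UnitScaleTilt.HistoryTailL`, ★★★★ `historyTailL_of_packageV3_of_growingTopHaarPushforward (hpkg)(π)(hTop♭∀)` and its two-row edition `…₂` (empty polymer fields).
(w8 g11's ✓`historyTailL_of_packageV3_of_massEnvelope` is the case `A₂ = 0`, ✓`AlphaInputsT3AC.OfV3At.growingMassEnvelope_of_massEnvelope` — not restated.)

HONEST SCOPE.  Bookkeeping; CONDITIONAL; hJ♭(v3) ∕ hTop♭ ∕ the v3 (α) package are DISPLAYED hypotheses, NOT proved (the kinematic rows are OPEN for `blockAvg ℰp`, the N08 loop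
part); nothing of `stub_hJ`, `stub_laneRecordsV3`, `hP′`, `HistoryTailL` (19936), the rung `YM3TorusSU2`, any continuum limit, d = 4, a mass gap or Clay is proved here; no summit
statement is proved by this seat.  R3 = YM₃ on T³, a rung — NOT the Clay problem.

References: T. Bałaban, Commun. Math. Phys. **102** (1985) 255–275 [Balaban1985UV3] (Thm 1 (5)–(6) pp.256–257, (2) p.256, (7) p.257, (40)–(41) p.266, (46)–(47) p.267, (64) p.273,
(67)–(71) p.273); T. Bałaban, Commun. Math. Phys. **109** (1987) 249–301 [Balaban1987RG1] ((0.11) p.253).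
-/

set_option autoImplicit false

noncomputable section

namespace Summit.QuantumFields.YangMills.Theorems.UnitScaleTiltHistoryTailOfPackageV3GrowingMassEnvelope

open MeasureTheory
open scoped BigOperators ENNReal
open Literature.MathematicalPhysics.QuantumFieldTheory.Balaban1983to89
open Literature.MathematicalPhysics.QuantumFieldTheory.Balaban1983to89.T3ContinuumYM3Torus
open Literature.MathematicalPhysics.QuantumFieldTheory.Balaban1983to89.T3UnitScaleTilt
open Literature.MathematicalPhysics.QuantumFieldTheory.Balaban1983to89.T3UnitLawDensityEML
open Literature.MathematicalPhysics.QuantumFieldTheory.Balaban1983to89.T3RestrictedUnitDensity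
open Literature.MathematicalPhysics.QuantumFieldTheory.Balaban1983to89.T3CruxEstimates
open Literature.MathematicalPhysics.QuantumFieldTheory.Balaban1983to89.T3AlphaInputsAC
open Literature.MathematicalPhysics.QuantumFieldTheory.Balaban1983to89.T4AvgSensitivity (iterFrom)
open Literature.MathematicalPhysics.QuantumFieldTheory.Balaban1983to89.Missing (boltzmann partitionFn)
open Literature.MathematicalPhysics.QuantumFieldTheory.Balaban1985CMP102
open Literature.MathematicalPhysics.QuantumFieldTheory.Balaban1985CMP102.Setting
open Summit.QuantumFields.Balaban3D.Carriers
open Summit.QuantumFields.Balaban3D.Proofs.Primitives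
open Summit.QuantumFields.Balaban3D.Proofs.GroupModelLieC
open Summit.QuantumFields.Balaban3D.Proofs.TowerAC
open Summit.QuantumFields.Balaban3D.Proofs.StandardAC
open Summit.QuantumFields.Balaban3D.Proofs.InputsAC
open Summit.QuantumFields.YangMills.Theorems.UV3UnitPartitionLowerOfPackage (resDensity_univ_eq)
open Summit.QuantumFields.YangMills.Theorems.UV3UnitPartitionLowerOfPackageV3 (exp_Ecst_le_partitionFn_of_packageV3)
open Summit.QuantumFields.YangMills.Theorems.UV3UnitEnvelopeSlackOfMassEnvelope (unitEnvelope_of_halves_slack)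
open Summit.QuantumFields.YangMills.Theorems.UV3PinnedStepV3FaceOfPackageV3 (stub_pinnedStepV3_of_packageV3_of_purePinTop)
open Summit.QuantumFields.YangMills.Theorems.UV3PinnedStepKnitOfPackageV3 (hPinA_of_pinnedLF_v3)
open Summit.QuantumFields.YangMills.Theorems.UnitScaleTiltPinnedHeightTailDoorExpSlack (pinnedHeightTail_of_exp')
open Summit.QuantumFields.YangMills.Theorems.UnitScaleTiltHistoryTailOfPinnedHeightTailFreeRate (historyTailL_of_pinnedHeightTail_freeRate)
open Summit.QuantumFields.YangMills.Theorems.UV3OrganOfGrowingMassEnvelopeV3 (massP_le_exp_ae_of_growingTopHaarPushforward)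

/-! ## §1 (U″)-v3 with a run-dependent leaf constant -/

section PerFamily

variable {F : T3Family} {𝔠 : AlphaConsts F.L (suGroupModel 2).N} {a₀ a₁ : ℝ}

/-- ★★ **(U)-HALF WITH A RUN-DEPENDENT TOP-LEAF CONSTANT** — px12 g12's ✓`UV3UnitEnvelopeFaceOfPackageV3.ae_emlDensity_top_le_of_lfTopV3_ae` re-run with the leaf row
`∀ K ≥ 1, ∀ᵐ W, LF_K(W)[r ↦ −mainT + Zterm] ≤ e^{CZ_K}` for an ARBITRARY `CZ : ℕ → ℝ`: `∃ Cu'', ∀ K, ∀ᵐ W, ρ_K W ≤ e^{|CZ_K|}·exp(−Ecst K K + Cu'')` with `Cu'' := log CRm + CP`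
K-FREE ((41)_K a.e. ✓`dataT3v3_ineq41AE`, remainder ✓`dataT3v3_rmSize`, (46) ✓`PkgAtV3.abs_Pint_succ_le` on the unit lattice; `K = 0`: `ρ₀ = e^{−β₀A} ≤ 1`).
[cite: Balaban1985UV3, (41) p.266, (46) p.267, (64) p.273, (67)–(71) pp.273–274] -/
theorem ae_emlDensity_top_le_of_lfTopV3Run_ae (h : AlphaInputsT3AC.OfV3At F 𝔠 a₀ a₁) (hc : 0 < a₀ ∧ 0 < a₁ ∧ 𝔠.B₃ * a₁ ≤ a₀)
    (γ : ℝ) (hγ : 0 < γ) (hγ1 : γ ≤ (min 𝔠.gamma0 1) ^ 2) (π : AlphaInputsT3AC.PolymerT3 F) (CZ : ℕ → ℝ)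
    (hlf : ∀ (K : ℕ), 1 ≤ K → ∀ᵐ W ∂fieldMeasure (F.P K) K (Matrix.specialUnitaryGroup (Fin 2) ℂ),
      (h.dataT3v3 hc γ hγ hγ1 π).LF K K W
          (fun r => -((h.dataT3v3 hc γ hγ hγ1 π).mainT K K r W) + (h.dataT3v3 hc γ hγ hγ1 π).Zterm K K r) ≤ Real.exp (CZ K)) :
    ∃ Cu' : ℝ, 0 ≤ Cu' ∧ ∀ K : ℕ, ∀ᵐ W ∂fieldMeasure (F.P K) K (Matrix.specialUnitaryGroup (Fin 2) ℂ),
      emlDensity F γ K K W ≤ Real.exp |CZ K| * Real.exp (-((h.dataT3v3 hc γ hγ hγ1 π).Ecst K K) + Cu') := by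
  set D := h.dataT3v3 hc γ hγ hγ1 π with hD
  -- the remainder: `Rm_K ≤ log CRm`, and `0 ≤ log CRm`
  obtain ⟨CRm, hCRm⟩ := exp_two_Rm_le (h.dataT3v3_rmSize hc γ hγ hγ1 π)
  have hCRm0 : 0 < CRm := (Real.exp_pos _).trans_le (hCRm 0 0 le_rfl)
  have hlog0 : 0 ≤ Real.log CRm := by
    have h0 : 0 ≤ D.Rm 0 0 := Rm_nonneg (h.dataT3v3_rmSize hc γ hγ hγ1 π) le_rfl
    have : (1 : ℝ) ≤ CRm := le_trans (by rw [← Real.exp_zero]; exact Real.exp_le_exp.mpr (by linarith)) (hCRm 0 0 le_rfl)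
    exact Real.log_nonneg this
  have hRm : ∀ K : ℕ, D.Rm K K ≤ Real.log CRm := by
    intro K
    have h0 : 0 ≤ D.Rm K K := Rm_nonneg (h.dataT3v3_rmSize hc γ hγ hγ1 π) le_rfl
    have h2 : Real.exp (2 * D.Rm K K) ≤ CRm := hCRm K K le_rfl
    have h1 : Real.exp (D.Rm K K) ≤ Real.exp (2 * D.Rm K K) := Real.exp_le_exp.mpr (by linarith)
    exact (Real.le_log_iff_exp_le hCRm0).mpr (h1.trans h2)
  -- the interaction sum at the top level, every history: `Pint ≤ CP`, `0 ≤ CP`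
  set CP : ℝ := 𝔠.C46 * (𝔠.M₁ : ℝ) ^ 3 * θBal F.L γ 𝔠.b₀ 𝔠.p₀ 1 ^ 2 * ((2 * F.L ^ F.m : ℕ) : ℝ) ^ 3 with hCPdef
  have hCP0 : 0 ≤ CP := by
    rw [hCPdef]
    exact mul_nonneg (mul_nonneg (mul_nonneg 𝔠.C46_nonneg (pow_nonneg (Nat.cast_nonneg _) _)) (sq_nonneg _))
      (pow_nonneg (Nat.cast_nonneg _) _)
  have hPint : ∀ (K : ℕ), 1 ≤ K → ∀ (r : Hist (F.P K) K) (W : GaugeField (F.P K) K (Matrix.specialUnitaryGroup (Fin 2) ℂ)),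
      D.Pint K K r W ≤ CP := by
    intro K hK r W
    obtain ⟨k, rfl⟩ : ∃ k, K = k + 1 := ⟨K - 1, by omega⟩
    have h46 := (h.pkgAtV3 hc γ hγ hγ1 (k + 1)).abs_Pint_succ_le k le_rfl r W
    have hvol := card_lamFin_le_sitesPerDir_cube (F := F) (K := k + 1) 𝔠.lane.carrier.M₁
      (rcolOf (T3Scales F γ hγ (hγ1.trans (sq_min_one_le _ 𝔠.gamma0_pos)) (k + 1)) 𝔠.lane.carrier) k r
    have hsites : ((F.P (k + 1)).sitesPerDir (k + 1) : ℝ) = ((2 * F.L ^ F.m : ℕ) : ℝ) := by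
      have : (F.P (k + 1)).sitesPerDir (k + 1) = 2 * F.L ^ F.m := by simp [Params.sitesPerDir]
      rw [this]
    have hk : k + 1 - k = 1 := by omega
    rw [hk] at h46
    rw [hsites] at hvol
    have hC : 0 ≤ 𝔠.C46 * (𝔠.M₁ : ℝ) ^ 3 * θBal F.L γ 𝔠.b₀ 𝔠.p₀ 1 ^ 2 :=
      mul_nonneg (mul_nonneg 𝔠.C46_nonneg (pow_nonneg (Nat.cast_nonneg _) _)) (sq_nonneg _)
    have hle := (abs_le.mp h46).2
    show (h.pkgAtV3 hc γ hγ hγ1 (k + 1)).T.Pint (k + 1) r W ≤ CP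
    calc (h.pkgAtV3 hc γ hγ hγ1 (k + 1)).T.Pint (k + 1) r W
        ≤ 𝔠.C46 * (𝔠.M₁ : ℝ) ^ 3 * θBal F.L γ 𝔠.b₀ 𝔠.p₀ 1 ^ 2 *
            ((LamFin 𝔠.lane.carrier.M₁
              (rcolOf (T3Scales F γ hγ (hγ1.trans (sq_min_one_le _ 𝔠.gamma0_pos)) (k + 1)) 𝔠.lane.carrier) k r).card : ℝ) := hle
      _ ≤ 𝔠.C46 * (𝔠.M₁ : ℝ) ^ 3 * θBal F.L γ 𝔠.b₀ 𝔠.p₀ 1 ^ 2 * ((2 * F.L ^ F.m : ℕ) : ℝ) ^ 3 :=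
            mul_le_mul_of_nonneg_left hvol hC
  refine ⟨Real.log CRm + CP, add_nonneg hlog0 hCP0, fun K => ?_⟩
  rcases Nat.eq_zero_or_pos K with hK0 | hKpos
  · -- the run K = 0: ρ₀ = e^{−β₀ A} ≤ 1 ≤ e^{|CZ 0|}·e^{Cu'}, Ecst 0 0 = 0
    subst hK0
    have hE : D.Ecst 0 0 = 0 := by
      rw [h.dataT3v3_Ecst_eq hc γ hγ hγ1 π 0 0 le_rfl]
      simp
    refine Filter.Eventually.of_forall fun W => ?_
    rw [hE, neg_zero, zero_add, emlDensity_zero, ← Real.exp_add]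
    show boltzmann (F.P 0) ((F.scheme ℰp γ).β 0) W ≤ _
    unfold boltzmann
    refine Real.exp_le_exp.mpr ?_
    have hA : 0 ≤ wilsonAction4 W := wilsonAction4_nonneg W
    have hβ : 0 ≤ (F.scheme ℰp γ).β 0 := F.scheme_β_nonneg ℰp hγ.le 0
    have hCZ0 : 0 ≤ |CZ 0| := abs_nonneg _
    nlinarith [hA, hβ, hlog0, hCP0, hCZ0]
  · have h41 : Ineq41AE D K K := h.dataT3v3_ineq41AE hc γ hγ hγ1 π K K le_rfl
    filter_upwards [h41, hlf K hKpos] with W hW hWZ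
    rw [← resDensity_univ_eq F γ K K]
    refine hW.trans ?_
    -- `up_K ≤ e^{CP}·LF[−mainT + Zterm] ≤ e^{CP}·e^{|CZ K|}`
    have hup : D.up K K W ≤ Real.exp CP * Real.exp |CZ K| := by
      have hLF : D.up K K W = ∑ r : Hist (F.P K) K, (h.pkgAtV3 hc γ hγ hγ1 K).wtP K r W *
          Real.exp (-(D.mainT K K r W) + D.Pint K K r W + D.Zterm K K r) := rfl
      have hLF' : D.LF K K W (fun r => -(D.mainT K K r W) + D.Zterm K K r) =
          ∑ r : Hist (F.P K) K, (h.pkgAtV3 hc γ hγ hγ1 K).wtP K r W * Real.exp (-(D.mainT K K r W) + D.Zterm K K r) := rfl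
      rw [hLF]
      calc ∑ r : Hist (F.P K) K, (h.pkgAtV3 hc γ hγ hγ1 K).wtP K r W * Real.exp (-(D.mainT K K r W) + D.Pint K K r W + D.Zterm K K r)
          ≤ ∑ r : Hist (F.P K) K, (h.pkgAtV3 hc γ hγ hγ1 K).wtP K r W * (Real.exp CP * Real.exp (-(D.mainT K K r W) + D.Zterm K K r)) := by
            refine Finset.sum_le_sum fun r _ => mul_le_mul_of_nonneg_left ?_ (h.wtP_nonneg hc γ hγ hγ1 K K r W)
            rw [← Real.exp_add]
            exact Real.exp_le_exp.mpr (by linarith [hPint K hKpos r W])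
        _ = Real.exp CP * D.LF K K W (fun r => -(D.mainT K K r W) + D.Zterm K K r) := by
            rw [hLF', Finset.mul_sum]
            refine Finset.sum_congr rfl fun r _ => by ring
        _ ≤ Real.exp CP * Real.exp |CZ K| :=
            mul_le_mul_of_nonneg_left (hWZ.trans (Real.exp_le_exp.mpr (le_abs_self _))) (Real.exp_pos _).le
    have hup0 : 0 ≤ D.up K K W := by
      have hLF : D.up K K W = ∑ r : Hist (F.P K) K, (h.pkgAtV3 hc γ hγ hγ1 K).wtP K r W *
          Real.exp (-(D.mainT K K r W) + D.Pint K K r W + D.Zterm K K r) := rfl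
      rw [hLF]
      exact Finset.sum_nonneg fun r _ => mul_nonneg (h.wtP_nonneg hc γ hγ hγ1 K K r W) (Real.exp_pos _).le
    calc Real.exp (-(D.Ecst K K) + D.Rm K K) * D.up K K W
        ≤ Real.exp (-(D.Ecst K K) + Real.log CRm) * (Real.exp CP * Real.exp |CZ K|) :=
          mul_le_mul (Real.exp_le_exp.mpr (by linarith [hRm K])) hup hup0 (Real.exp_pos _).le
      _ = Real.exp |CZ K| * Real.exp (-(D.Ecst K K) + (Real.log CRm + CP)) := by
          rw [← Real.exp_add, ← Real.exp_add, ← Real.exp_add]; ring_nf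

/-! ## §2 The unit envelope with exponential slack, per `(F, γ)`, from the v3 socket and hJ♭(v3) -/

/-- ★★★ **THE UNIT ENVELOPE WITH EXPONENTIAL SLACK FROM THE v3 SOCKET AND hJ♭(v3)** (per `(F, γ)` in the window where the (47)-half's thresholds hold):
`∃ Cl A₂, 0 ≤ A₂ ∧ ∀ K, ρ_K ≤ e^{A₂K}·(e^{Cl}·Z_K)` `dV_K`-a.e. — the leaf with exponential slack ✓`AlphaInputsT3AC.OfV3At.hlfExp_ae_of_growingMassEnvelope`, §1 at `CZ_K := CZ + A₂K`
(`e^{|CZ + A₂K|} ≤ e^{A₂K}·e^{|CZ|}`), the lower half ✓`exp_Ecst_le_partitionFn_of_packageV3`, knit by ✓`unitEnvelope_of_halves_slack` at `s_K := e^{A₂K}`.  This is the per-`(F, γ)` body of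
K-24's `hLowExp`. [cite: Balaban1985UV3, Thm 1 (5)–(6) pp.256–257, (41) p.266, (46)–(47) p.267, pp.273–274] -/
theorem _root_.Summit.QuantumFields.YangMills.Theorems.AlphaInputsT3AC.OfV3At.unitEnvelopeExp_of_growingMassEnvelope
    (h : AlphaInputsT3AC.OfV3At F 𝔠 a₀ a₁) (hc : 0 < a₀ ∧ 0 < a₁ ∧ 𝔠.B₃ * a₁ ≤ a₀)
    (γ : ℝ) (hγ : 0 < γ) (hγ1 : γ ≤ (min 𝔠.gamma0 1) ^ 2) (π : AlphaInputsT3AC.PolymerT3 F)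
    (ha₁ : θBal F.L γ 𝔠.b₀ 𝔠.p₀ 0 ≤ a₁) (ha₀ : 𝔠.B₃ * θBal F.L γ 𝔠.b₀ 𝔠.p₀ 0 ≤ a₀)
    (hJ : ∃ A₁ A₂ : ℝ, ∀ (K : ℕ) (r : Hist (F.P K) K),
      Hist.Admissible 𝔠.lane.carrier.M₁ (rcolOf (T3Scales F γ hγ (hγ1.trans (sq_min_one_le _ 𝔠.gamma0_pos)) K) 𝔠.lane.carrier) K r →
      r ≠ Hist.triv (F.P K) K →
      ∀ᵐ W ∂(fieldMeasure (F.P K) K (Matrix.specialUnitaryGroup (Fin 2) ℂ)),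
        PinnedStep.massP 𝔠.lane (h.pkgAtV3 hc γ hγ hγ1 K).X K r W ≤ Real.exp (A₁ + A₂ * K)) :
    ∃ (Cl A₂ : ℝ), 0 ≤ A₂ ∧ ∀ K : ℕ, ∀ᵐ V ∂(fieldMeasure (F.P K) K (Matrix.specialUnitaryGroup (Fin 2) ℂ)),
      emlDensity F γ K K V ≤
        Real.exp (A₂ * K) * (Real.exp Cl * partitionFn (G := Matrix.specialUnitaryGroup (Fin 2) ℂ) (F.P K) ((F.scheme ℰp γ).β K)) := by
  obtain ⟨CZ, A₂, hA₂, hlf⟩ := h.hlfExp_ae_of_growingMassEnvelope hc γ hγ hγ1 π hJ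
  -- §1 at the run-dependent leaf constant `CZ + A₂ K`
  have hlf' : ∀ (K : ℕ), 1 ≤ K → ∀ᵐ W ∂fieldMeasure (F.P K) K (Matrix.specialUnitaryGroup (Fin 2) ℂ),
      (h.dataT3v3 hc γ hγ hγ1 π).LF K K W
          (fun r => -((h.dataT3v3 hc γ hγ hγ1 π).mainT K K r W) + (h.dataT3v3 hc γ hγ hγ1 π).Zterm K K r) ≤
        Real.exp (CZ + A₂ * (K : ℝ)) := by
    intro K hK
    filter_upwards [hlf K hK] with W hW
    rw [Real.exp_add, mul_comm]
    exact hW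
  obtain ⟨Cu', hCu'0, hU⟩ := ae_emlDensity_top_le_of_lfTopV3Run_ae h hc γ hγ hγ1 π (fun K => CZ + A₂ * (K : ℝ)) hlf'
  -- the upper half in slack form `s_K·e^{−E_K + (Cu' + |CZ|)}`
  have hU' : ∃ Cu'' : ℝ, ∀ K : ℕ, ∀ᵐ V ∂fieldMeasure (F.P K) K (Matrix.specialUnitaryGroup (Fin 2) ℂ),
      emlDensity F γ K K V ≤ Real.exp (A₂ * (K : ℝ)) * Real.exp (-((h.dataT3v3 hc γ hγ hγ1 π).Ecst K K) + Cu'') := by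
    refine ⟨Cu' + |CZ|, fun K => ?_⟩
    have hAK : 0 ≤ A₂ * (K : ℝ) := mul_nonneg hA₂ (Nat.cast_nonneg K)
    have habs : |CZ + A₂ * (K : ℝ)| ≤ A₂ * (K : ℝ) + |CZ| := by
      calc |CZ + A₂ * (K : ℝ)| ≤ |CZ| + |A₂ * (K : ℝ)| := abs_add_le _ _
        _ = A₂ * (K : ℝ) + |CZ| := by rw [abs_of_nonneg hAK, add_comm]
    filter_upwards [hU K] with V hV
    refine hV.trans ?_
    calc Real.exp |CZ + A₂ * (K : ℝ)| * Real.exp (-((h.dataT3v3 hc γ hγ hγ1 π).Ecst K K) + Cu')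
        ≤ Real.exp (A₂ * (K : ℝ) + |CZ|) * Real.exp (-((h.dataT3v3 hc γ hγ hγ1 π).Ecst K K) + Cu') :=
          mul_le_mul_of_nonneg_right (Real.exp_le_exp.mpr habs) (Real.exp_pos _).le
      _ = Real.exp (A₂ * (K : ℝ)) * Real.exp (-((h.dataT3v3 hc γ hγ hγ1 π).Ecst K K) + (Cu' + |CZ|)) := by
          rw [← Real.exp_add, ← Real.exp_add]; ring_nf
  obtain ⟨Cl', hCl'⟩ := unitEnvelope_of_halves_slack F hγ.le (fun K => Real.exp (A₂ * (K : ℝ))) (fun K => (Real.exp_pos _).le)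
    (fun K => (h.dataT3v3 hc γ hγ hγ1 π).Ecst K K) hU' (exp_Ecst_le_partitionFn_of_packageV3 h hc γ hγ hγ1 π ha₁ ha₀)
  exact ⟨Cl', A₂, hA₂, hCl'⟩

end PerFamily

/-! ## §3 The `∀ L` letters at the guarded v3 socket -/

/-- ★★ **THE `∀ L` UNIT-ENVELOPE LETTER WITH EXPONENTIAL SLACK (K-24's `hLowExp`, VERBATIM) FROM THE GUARDED v3 SOCKET, `π` AND hJ♭(v3)∀** — §2 family by family at the socket's
record for the block size; the coupling threshold is the minimum of the socket window `(min γ₀ 1)²` and the two `θBal(0)`-smallness thresholds of the (47)-half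
(✓`T3Thresholds.exists_gamma_forall_mul_θBal_le`), exactly as in px12 g12's ✓`stub_unitEnvelope_of_packageV3_of_lfTop_ae`; `L ≤ 1` vacuous (`T3Family.hL`).
[cite: Balaban1985UV3, Thm 1 (5)–(6) pp.256–257, (41) p.266, (47) p.267] -/
theorem unitEnvelopeExp_forall_of_packageV3_of_growingMassEnvelope
    (hpkg : ∀ L : ℕ, 1 < L → ∃ (𝔠 : AlphaConsts L (suGroupModel 2).N) (a₀ a₁ : ℝ),
      (0 < a₀ ∧ 0 < a₁ ∧ 𝔠.B₃ * a₁ ≤ a₀) ∧ ∀ (F : T3Family) (hF : F.L = L), AlphaInputsT3AC.OfV3At F (hF ▸ 𝔠) a₀ a₁)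
    (π : ∀ F : T3Family, AlphaInputsT3AC.PolymerT3 F)
    (hJ : ∀ (F : T3Family) (𝔠 : AlphaConsts F.L (suGroupModel 2).N) (a₀ a₁ : ℝ) (h : AlphaInputsT3AC.OfV3At F 𝔠 a₀ a₁)
      (hc : 0 < a₀ ∧ 0 < a₁ ∧ 𝔠.B₃ * a₁ ≤ a₀) (γ : ℝ) (hγ : 0 < γ) (hγ1 : γ ≤ (min 𝔠.gamma0 1) ^ 2),
      ∃ A₁ A₂ : ℝ, ∀ (K : ℕ) (r : Hist (F.P K) K),
        Hist.Admissible 𝔠.lane.carrier.M₁ (rcolOf (T3Scales F γ hγ (hγ1.trans (sq_min_one_le _ 𝔠.gamma0_pos)) K) 𝔠.lane.carrier) K r →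
        r ≠ Hist.triv (F.P K) K →
        ∀ᵐ W ∂(fieldMeasure (F.P K) K (Matrix.specialUnitaryGroup (Fin 2) ℂ)),
          PinnedStep.massP 𝔠.lane (h.pkgAtV3 hc γ hγ hγ1 K).X K r W ≤ Real.exp (A₁ + A₂ * K)) :
    ∀ (L : ℕ), ∃ γ₁ : ℝ, 0 < γ₁ ∧ ∀ (F : T3Family) (γ : ℝ), F.L = L → 0 < γ → γ ≤ γ₁ →
      ∃ (Cl A₂ : ℝ), 0 ≤ A₂ ∧ ∀ K : ℕ, ∀ᵐ V ∂(fieldMeasure (F.P K) K (Matrix.specialUnitaryGroup (Fin 2) ℂ)),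
        emlDensity F γ K K V ≤
          Real.exp (A₂ * K) * (Real.exp Cl * partitionFn (G := Matrix.specialUnitaryGroup (Fin 2) ℂ) (F.P K) ((F.scheme ℰp γ).β K)) := by
  intro L
  by_cases hL : 1 < L
  · obtain ⟨𝔠, a₀, a₁, hc, hOf⟩ := hpkg L hL
    obtain ⟨γa, hγa, -, ha⟩ := T3Thresholds.exists_gamma_forall_mul_θBal_le (b₀ := 𝔠.b₀) (p₀ := 𝔠.p₀) 𝔠.b₀_pos 𝔠.p₀_pos
      (B := 1) zero_le_one (ε₀ := a₁) hc.2.1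
    obtain ⟨γb, hγb, -, hb⟩ := T3Thresholds.exists_gamma_forall_mul_θBal_le (b₀ := 𝔠.b₀) (p₀ := 𝔠.p₀) 𝔠.b₀_pos 𝔠.p₀_pos
      (B := 𝔠.B₃) 𝔠.B₃_pos.le (ε₀ := a₀) hc.1
    have hγ0 : 0 < (min 𝔠.gamma0 1) ^ 2 := by
      have := 𝔠.gamma0_pos
      positivity
    refine ⟨min ((min 𝔠.gamma0 1) ^ 2) (min γa γb), lt_min hγ0 (lt_min hγa hγb), ?_⟩
    intro F γ hF hγ hγle
    subst hF
    have h : AlphaInputsT3AC.OfV3At F 𝔠 a₀ a₁ := hOf F rfl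
    have hγ1 : γ ≤ (min 𝔠.gamma0 1) ^ 2 := hγle.trans (min_le_left _ _)
    have hL1 : 1 ≤ F.L := le_of_lt F.hL.2
    have ha₁ : θBal F.L γ 𝔠.b₀ 𝔠.p₀ 0 ≤ a₁ := by
      have := ha F.L hL1 γ hγ (hγle.trans ((min_le_right _ _).trans (min_le_left _ _))) 0
      simpa using this
    have ha₀ : 𝔠.B₃ * θBal F.L γ 𝔠.b₀ 𝔠.p₀ 0 ≤ a₀ :=
      hb F.L hL1 γ hγ (hγle.trans ((min_le_right _ _).trans (min_le_right _ _))) 0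
    exact h.unitEnvelopeExp_of_growingMassEnvelope hc γ hγ hγ1 (π F) ha₁ ha₀ (hJ F 𝔠 a₀ a₁ h hc γ hγ hγ1)
  · -- no three-torus family has block size `L ≤ 1`
    exact ⟨1, one_pos, fun F γ hF _ _ => absurd (hF ▸ F.hL.2) hL⟩

/-- ★★ **THE v3 S-FACE's `hPinA` (✓p749641's binder, VERBATIM, for every polymer datum `π`) FROM hJ♭(v3)∀** — per block size the threshold `γ₁ := 1`, per family `subst hF`,
then ✓`AlphaInputsT3AC.OfV3At.hSii_of_growingMassEnvelope` feeds ✓`hPinA_of_pinnedLF_v3` (the skeleton v4's §1a `purePinTop_of_hJ` with the relaxed row).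
[cite: Balaban1985UV3, (40)–(41) p.266 + (46) p.267 + (64) p.273 + (67)–(71) pp.273–274] -/
theorem purePinTop_forall_of_growingMassEnvelope (π : ∀ F : T3Family, AlphaInputsT3AC.PolymerT3 F)
    (hJ : ∀ (F : T3Family) (𝔠 : AlphaConsts F.L (suGroupModel 2).N) (a₀ a₁ : ℝ) (h : AlphaInputsT3AC.OfV3At F 𝔠 a₀ a₁)
      (hc : 0 < a₀ ∧ 0 < a₁ ∧ 𝔠.B₃ * a₁ ≤ a₀) (γ : ℝ) (hγ : 0 < γ) (hγ1 : γ ≤ (min 𝔠.gamma0 1) ^ 2),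
      ∃ A₁ A₂ : ℝ, ∀ (K : ℕ) (r : Hist (F.P K) K),
        Hist.Admissible 𝔠.lane.carrier.M₁ (rcolOf (T3Scales F γ hγ (hγ1.trans (sq_min_one_le _ 𝔠.gamma0_pos)) K) 𝔠.lane.carrier) K r →
        r ≠ Hist.triv (F.P K) K →
        ∀ᵐ W ∂(fieldMeasure (F.P K) K (Matrix.specialUnitaryGroup (Fin 2) ℂ)),
          PinnedStep.massP 𝔠.lane (h.pkgAtV3 hc γ hγ hγ1 K).X K r W ≤ Real.exp (A₁ + A₂ * K)) :
    ∀ (L : ℕ) (𝔠 : AlphaConsts L (suGroupModel 2).N) (a₀ a₁ : ℝ),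
      (0 < a₀ ∧ 0 < a₁ ∧ 𝔠.B₃ * a₁ ≤ a₀) →
      ∀ (hOf : ∀ (F : T3Family) (hF : F.L = L), AlphaInputsT3AC.OfV3At F (hF ▸ 𝔠) a₀ a₁),
        ∀ (m : ℕ), 0 < m →
          ∃ γ₁ : ℝ, 0 < γ₁ ∧ ∀ (F : T3Family) (hF : F.L = L)
            (hc' : 0 < a₀ ∧ 0 < a₁ ∧ (hF ▸ 𝔠).B₃ * a₁ ≤ a₀) (γ : ℝ) (hγ : 0 < γ) (hγ1' : γ ≤ (min (hF ▸ 𝔠).gamma0 1) ^ 2), γ ≤ γ₁ →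
            ∃ (Cu c : ℝ) (A : ℕ), 0 < c ∧
              ∀ (K j : ℕ), 1 ≤ j → j + 2 ≤ K → j + (K - 1) / m ≤ K → ∀ (a : Plaq (F.P K) j),
                ∀ᵐ V ∂(fieldMeasure (F.P K) K (Matrix.specialUnitaryGroup (Fin 2) ℂ)),
                  resDensity F γ K
                    {U : GaugeField (F.P K) 0 (Matrix.specialUnitaryGroup (Fin 2) ℂ) |
                      θBal F.L γ (hF ▸ 𝔠).b₀ (hF ▸ 𝔠).p₀ (K - j) ≤ GaugeGroup.dist1 (GaugeField.plaqHol
                        (Averaging.iter (fun i' => BlockAveraging.blockAvg (P := F.P K) (j := i') ℰp) j U) a)}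
                    K V ≤
                  Real.exp (-(((hOf F hF).dataT3v3 hc' γ hγ hγ1' (π F)).Ecst K K) + Cu) *
                    ((F.scheme ℰp γ).β (K - j) ^ A *
                      Real.exp (-(c * B10.pFun (hF ▸ 𝔠).b₀ (hF ▸ 𝔠).p₀ (Real.sqrt (γ * ((F.L : ℝ)⁻¹) ^ (K - j))) ^ 2))) :=
  hPinA_of_pinnedLF_v3 π
    (fun L 𝔠 a₀ a₁ _ hOf m hm => ⟨1, one_pos, fun F hF hc' γ hγ hγ1' _ => by
      subst hF
      exact (hOf F rfl).hSii_of_growingMassEnvelope hc' γ hγ hγ1' hm (hJ F 𝔠 a₀ a₁ (hOf F rfl) hc' γ hγ hγ1')⟩)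

/-! ## §4 The pinned height tail and the crux by name -/

/-- ★★★ **THE PINNED HEIGHT TAIL `hP′` (✓p748552's hypothesis, VERBATIM) FROM THE GUARDED v3 SOCKET, `π` AND hJ♭(v3)∀** — K-24 ✓`pinnedHeightTail_of_exp'` fed with the v3 S-face
✓`stub_pinnedStepV3_of_packageV3_of_purePinTop (hpkg)(π)(§3 S)` and §3 U. [cite: Balaban1985UV3, Thm 1 (5) p.256, (2) p.256, (6)–(7) p.257, (41) p.266, (47) p.267, (67)–(71) p.273] -/
theorem pinnedHeightTail_of_packageV3_of_growingMassEnvelope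
    (hpkg : ∀ L : ℕ, 1 < L → ∃ (𝔠 : AlphaConsts L (suGroupModel 2).N) (a₀ a₁ : ℝ),
      (0 < a₀ ∧ 0 < a₁ ∧ 𝔠.B₃ * a₁ ≤ a₀) ∧ ∀ (F : T3Family) (hF : F.L = L), AlphaInputsT3AC.OfV3At F (hF ▸ 𝔠) a₀ a₁)
    (π : ∀ F : T3Family, AlphaInputsT3AC.PolymerT3 F)
    (hJ : ∀ (F : T3Family) (𝔠 : AlphaConsts F.L (suGroupModel 2).N) (a₀ a₁ : ℝ) (h : AlphaInputsT3AC.OfV3At F 𝔠 a₀ a₁)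
      (hc : 0 < a₀ ∧ 0 < a₁ ∧ 𝔠.B₃ * a₁ ≤ a₀) (γ : ℝ) (hγ : 0 < γ) (hγ1 : γ ≤ (min 𝔠.gamma0 1) ^ 2),
      ∃ A₁ A₂ : ℝ, ∀ (K : ℕ) (r : Hist (F.P K) K),
        Hist.Admissible 𝔠.lane.carrier.M₁ (rcolOf (T3Scales F γ hγ (hγ1.trans (sq_min_one_le _ 𝔠.gamma0_pos)) K) 𝔠.lane.carrier) K r →
        r ≠ Hist.triv (F.P K) K →
        ∀ᵐ W ∂(fieldMeasure (F.P K) K (Matrix.specialUnitaryGroup (Fin 2) ℂ)),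
          PinnedStep.massP 𝔠.lane (h.pkgAtV3 hc γ hγ hγ1 K).X K r W ≤ Real.exp (A₁ + A₂ * K)) :
    ∀ (L : ℕ), ∃ (b₁' p₁' : ℝ), ∀ (b₀ p₀ : ℝ), b₁' ≤ b₀ → p₁' ≤ p₀ → 0 < b₀ → 2 < p₀ → ∀ (m : ℕ), 0 < m →
      ∃ γ₁ : ℝ, 0 < γ₁ ∧ γ₁ ≤ 1 ∧ ∀ (F : T3Family) (γ : ℝ), F.L = L → 0 < γ → γ ≤ γ₁ →
        ∃ (b p C c : ℝ) (A : ℕ), 0 < b ∧ 1 ≤ p ∧ 0 ≤ C ∧ 0 < c ∧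
          ∀ (K j : ℕ), 1 ≤ j → j + 2 ≤ K → j + (K - 1) / m ≤ K → ∀ a : Plaq (F.P K) j,
          (gibbsK F ℰp γ K).real
              ({U : GaugeField (F.P K) 0 (Matrix.specialUnitaryGroup (Fin 2) ℂ) |
                  θBal F.L γ b₀ p₀ (K - j) ≤ GaugeGroup.dist1 (GaugeField.plaqHol
                    (Averaging.iter (fun i' => BlockAveraging.blockAvg (P := F.P K) (j := i') ℰp) j U) a)} ∩
                {U : GaugeField (F.P K) 0 (Matrix.specialUnitaryGroup (Fin 2) ℂ) | ∀ i, i < j →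
                  PlaqSmall (θBal F.L γ b₀ p₀ (K - i))
                    (Averaging.iter (fun i' => BlockAveraging.blockAvg (P := F.P K) (j := i') ℰp) i U)}) ≤
            C * (F.scheme ℰp γ).β (K - j) ^ A *
              Real.exp (-(c * B10.pFun b p (Real.sqrt (γ * ((F.L : ℝ)⁻¹) ^ (K - j))) ^ 2)) :=
  pinnedHeightTail_of_exp'
    (stub_pinnedStepV3_of_packageV3_of_purePinTop hpkg π (purePinTop_forall_of_growingMassEnvelope π hJ))
    (unitEnvelopeExp_forall_of_packageV3_of_growingMassEnvelope hpkg π hJ)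

/-- ★★★★ **`UnitScaleTilt.HistoryTailL` (stmt-QuantumFields-19936) FROM THE GUARDED v3 (α) SOCKET, THE POLYMER FIELDS AND hJ♭(v3)∀** — the registry-v4 shape with the S∕U
organ row RELAXED to a `K`-linear log-envelope: THREE displayed rows `hpkg` (the UV3 node's (α) input records, guarded), `π` (a parameter), hJ♭(v3) «for every family, record and
socket datum, coupling in the window: `∃ A₁ A₂, ∀ K r, Admissible r → r ≠ triv → massP_K(r,·) ≤ e^{A₁ + A₂·K}` a.e.».  One `exact` over ✓p748552.  CONDITIONAL: closes nothing.
R3 = YM₃ on T³, a rung — NOT d = 4, NOT infinite volume, NOT a mass gap, NOT Clay. [cite: Balaban1985UV3, Thm 1 (5) p.256, (2) p.256, (41) p.266, (47) p.267, (67)–(71) p.273] -/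
theorem historyTailL_of_packageV3_of_growingMassEnvelope
    (hpkg : ∀ L : ℕ, 1 < L → ∃ (𝔠 : AlphaConsts L (suGroupModel 2).N) (a₀ a₁ : ℝ),
      (0 < a₀ ∧ 0 < a₁ ∧ 𝔠.B₃ * a₁ ≤ a₀) ∧ ∀ (F : T3Family) (hF : F.L = L), AlphaInputsT3AC.OfV3At F (hF ▸ 𝔠) a₀ a₁)
    (π : ∀ F : T3Family, AlphaInputsT3AC.PolymerT3 F)
    (hJ : ∀ (F : T3Family) (𝔠 : AlphaConsts F.L (suGroupModel 2).N) (a₀ a₁ : ℝ) (h : AlphaInputsT3AC.OfV3At F 𝔠 a₀ a₁)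
      (hc : 0 < a₀ ∧ 0 < a₁ ∧ 𝔠.B₃ * a₁ ≤ a₀) (γ : ℝ) (hγ : 0 < γ) (hγ1 : γ ≤ (min 𝔠.gamma0 1) ^ 2),
      ∃ A₁ A₂ : ℝ, ∀ (K : ℕ) (r : Hist (F.P K) K),
        Hist.Admissible 𝔠.lane.carrier.M₁ (rcolOf (T3Scales F γ hγ (hγ1.trans (sq_min_one_le _ 𝔠.gamma0_pos)) K) 𝔠.lane.carrier) K r →
        r ≠ Hist.triv (F.P K) K →
        ∀ᵐ W ∂(fieldMeasure (F.P K) K (Matrix.specialUnitaryGroup (Fin 2) ℂ)),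
          PinnedStep.massP 𝔠.lane (h.pkgAtV3 hc γ hγ hγ1 K).X K r W ≤ Real.exp (A₁ + A₂ * K)) :
    Summit.QuantumFields.YangMills.Theses.UnitScaleTilt.HistoryTailL :=
  historyTailL_of_pinnedHeightTail_freeRate (pinnedHeightTail_of_packageV3_of_growingMassEnvelope hpkg π hJ)

/-- ★★★★ **`UnitScaleTilt.HistoryTailL` FROM THE GUARDED v3 SOCKET, `π` AND THE RUN-LINEAR TOP LETTER hTop♭∀** — the v3 twin of ✓p755934 (no `hMain`): per family
✓`UV3OrganOfGrowingMassEnvelopeV3.massP_le_exp_ae_of_growingTopHaarPushforward` gives hJ♭(v3) for every package (flat in the pinned currency), then the face above.  THREE displayed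
rows: `hpkg`, `π`, hTop♭ «∀ F, ∃ c₀ c₁, ∀ K j n, j + n = K → (dU_j)∘(iterFrom (avT3 F K) j n)⁻¹ ≤ e^{c₀ + c₁·K}·dU_{j+n}».  CONDITIONAL: closes nothing.
[cite: Balaban1985UV3, Thm 1 (5) p.256, (2) p.256, (41) p.266, (48) p.268; Balaban1987RG1, (0.11) p.253] -/
theorem historyTailL_of_packageV3_of_growingTopHaarPushforward
    (hpkg : ∀ L : ℕ, 1 < L → ∃ (𝔠 : AlphaConsts L (suGroupModel 2).N) (a₀ a₁ : ℝ),
      (0 < a₀ ∧ 0 < a₁ ∧ 𝔠.B₃ * a₁ ≤ a₀) ∧ ∀ (F : T3Family) (hF : F.L = L), AlphaInputsT3AC.OfV3At F (hF ▸ 𝔠) a₀ a₁)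
    (π : ∀ F : T3Family, AlphaInputsT3AC.PolymerT3 F)
    (hTop : ∀ F : T3Family, ∃ c₀ c₁ : ℝ, ∀ (K j n : ℕ), j + n = K →
      (fieldMeasure (F.P K) j (Matrix.specialUnitaryGroup (Fin 2) ℂ)).map (iterFrom (avT3 F K) j n) ≤
        ENNReal.ofReal (Real.exp (c₀ + c₁ * (K : ℝ))) • fieldMeasure (F.P K) (j + n) (Matrix.specialUnitaryGroup (Fin 2) ℂ)) :
    Summit.QuantumFields.YangMills.Theses.UnitScaleTilt.HistoryTailL :=
  historyTailL_of_packageV3_of_growingMassEnvelope hpkg π fun F 𝔠 a₀ a₁ h hc γ hγ hγ1 => by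
    obtain ⟨A₁, A₂, hA⟩ := massP_le_exp_ae_of_growingTopHaarPushforward F 𝔠 γ hγ hγ1 (hTop F)
    exact ⟨A₁, A₂, fun K r _ _ => hA K (h.pkgAtV3 hc γ hγ hγ1 K) r⟩

/-- ★★★★ **TWO ROWS: `UnitScaleTilt.HistoryTailL` FROM THE GUARDED v3 (α) SOCKET AND hTop♭∀** — the previous face at the EMPTY polymer fields (inline `Loc := ∅`,
`Pterm := 0`, `enl := id`, `treeLen := 0`, as in `ym-ust-19936-w8` g11's ✓`historyTailL_of_packageV3_of_topHaarPushforward₂`); the run-linear twin of that two-row face.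
CONDITIONAL — a face. [cite: Balaban1985UV3, Thm 1 (5) p.256, (41) p.266, (48) p.268; Balaban1987RG1, (0.11) p.253] -/
theorem historyTailL_of_packageV3_of_growingTopHaarPushforward₂
    (hpkg : ∀ L : ℕ, 1 < L → ∃ (𝔠 : AlphaConsts L (suGroupModel 2).N) (a₀ a₁ : ℝ),
      (0 < a₀ ∧ 0 < a₁ ∧ 𝔠.B₃ * a₁ ≤ a₀) ∧ ∀ (F : T3Family) (hF : F.L = L), AlphaInputsT3AC.OfV3At F (hF ▸ 𝔠) a₀ a₁)
    (hTop : ∀ F : T3Family, ∃ c₀ c₁ : ℝ, ∀ (K j n : ℕ), j + n = K →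
      (fieldMeasure (F.P K) j (Matrix.specialUnitaryGroup (Fin 2) ℂ)).map (iterFrom (avT3 F K) j n) ≤
        ENNReal.ofReal (Real.exp (c₀ + c₁ * (K : ℝ))) • fieldMeasure (F.P K) (j + n) (Matrix.specialUnitaryGroup (Fin 2) ℂ)) :
    Summit.QuantumFields.YangMills.Theses.UnitScaleTilt.HistoryTailL :=
  historyTailL_of_packageV3_of_growingTopHaarPushforward hpkg (fun _ => ⟨fun _ _ _ _ => ∅, fun _ _ _ _ => 0, fun _ _ X => X, fun _ _ _ => 0⟩) hTop

end Summit.QuantumFields.YangMills.Theorems.UnitScaleTiltHistoryTailOfPackageV3GrowingMassEnvelope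

end
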